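import Literature.AlgebraicGeometry.Frobenioids.ArchimedeanConjugateLifts
import Literature.AlgebraicGeometry.Frobenioids.ArchimedeanArcPowers
import Literature.AlgebraicGeometry.Frobenioids.CircleOpensProofs4
import Literature.AlgebraicGeometry.Frobenioids.CircleOpensProofs5
import HarnessLib

/-!
# Frobenioids II, Proposition 3.4 (ii), condition (b): the circle-geometry step
# (abc-iut cell, layer L1, node `FrdII:Prop3.4(ii)`, sub-nodes P34-L02/L03; helper file)

Mochizuki, *The geometry of Frobenioids II: poly-Frobenioids*, Kyushu J. Math. **62** (2008)
401–460, §3, Proposition 3.4 (ii) p. 30, proof p. 30 ll. 30–38, and Lemma 3.2 (ii) p. 25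
[cite: MochizukiFrdII2008, Prop 3.4 (ii) p.30].

In the proof of Prop. 3.4 (ii) under condition (b) one needs, for `φ₀ : X → Y` in `C₀` with `X`
complex and `Y` real, the pair of "conjugate" linear isometric lifts `a₀, b₀ : Z → X` over
`id, conj : Spec ℂ → Spec ℂ` with `φ₀ ∘ a₀ = φ₀ ∘ b₀` (print: "it follows from [the latter portion of]
Lemma 3.2, (ii)"). abc-iut-L1-d3 reduced this (`ArchimedeanConjugateArcs/Lifts.lean`) to the existence
of a point `p` of the angular part `B_X` with `p^{2d} = (c_φ/|c_φ|)^{-4}·…`, precisely `p ^ (2d) = (v²)⁻¹`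
for `v = c_φ/|c_φ|` and `d = deg_Fr(φ₀)`. This PROOF-ONLY file supplies that point from the geometric
content of condition (b): if a translate of the `d`-fold product `B_X · … · B_X ⊆ S¹` misses at most
one point of `S¹`, then `z ↦ z^{2d}` maps `B_X` ONTO `S¹` (an open arc of length `ℓ` has `d`-fold
product of length `dℓ`, so `dℓ ≥ 2π` and the `2d`-th power wraps `B_X` at least twice around the
circle; the identification of the `d`-fold product of an arc with the arc of `d` times the width is
abc-iut's `ArchimedeanArcPowers.lean`) — `CircleOpens.phi_image_eq_univ_of_compl_subset`, transported to `O_ℂ^× = normOneSubgroup ℂ`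
(`ArchFrd.exists_mem_pow_eq_of_compl_subset`), and the resulting conjugate pair
`ArchFrd.C0.exists_conj_pair_of_compl_subset`. Nothing is defined; no side is taken on [IUTchIII]
Cor. 3.12.
-/

namespace Literature.AlgebraicGeometry.Frobenioids

open CategoryTheory Set Function Topology Real
open scoped Pointwise

noncomputable section

namespace CircleOpens

/-- **The circle-geometry step of Prop. 3.4 (ii) (b).** If a connected open `A ⊆ S¹` has a translate of
its `d`-fold product `A ⋯ A` (`d ≥ 1`) containing all of `S¹` but possibly one point, then
`φ_{2d}(A) = S¹` (`A` is an arc of length `ℓ` with `dℓ ≥ 2π`). [cite: MochizukiFrdII2008, Prop 3.4 (ii) p.30] -/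
theorem phi_image_eq_univ_of_compl_subset {A : Set Circle} (hA : IsConnected A) (hAo : IsOpen A)
    {d : ℕ} (hd : 0 < d) {e q : Circle} (h : ({q}ᶜ : Set Circle) ⊆ e • A ^ d) :
    phi (2 * (d : ℤ)) '' A = univ := by
  by_cases hA1 : A = univ
  · subst hA1
    exact phi_image_univ (by positivity)
  obtain ⟨c, c', hcc', hlen, rfl⟩ := exists_eq_exp_image_Ioo hA hAo hA1
  obtain ⟨k, rfl⟩ := Nat.exists_eq_succ_of_ne_zero hd.ne'
  obtain ⟨θ, rfl⟩ := Circle.exp_surjective e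
  set ℓ := c' - c with hℓ
  have hℓ0 : 0 < ℓ := by rw [hℓ]; linarith
  have hc' : c' = c + ℓ := by rw [hℓ]; ring
  -- the translate of the product arc, in coordinates (`A^{k+1}` is the arc of `k+1` times the width)
  have harc : Circle.exp θ • (Circle.exp '' Ioo c c') ^ (k + 1) =
      Circle.exp '' Ioo (θ + ((k : ℝ) + 1) * c) (θ + ((k : ℝ) + 1) * (c + ℓ)) := by
    rw [ArchFrd.CircleAux2.exp_image_Ioo_pow hcc' k, exp_smul_exp_image, image_const_add_Ioo, hc']
  rw [Nat.succ_eq_add_one, harc] at h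
  -- the product arc has length `(k+1) ℓ ≥ 2π`
  have hbig : 2 * π ≤ ((k : ℝ) + 1) * ℓ := by
    by_contra hlt
    push Not at hlt
    have hkl : 0 < ((k : ℝ) + 1) * ℓ := by positivity
    have hdiff := univ_diff_arc (a := θ + ((k : ℝ) + 1) * c) (b := θ + ((k : ℝ) + 1) * (c + ℓ))
      (by nlinarith) (by nlinarith)
    have hout : ∀ x ∈ Icc (θ + ((k : ℝ) + 1) * (c + ℓ)) (θ + ((k : ℝ) + 1) * c + 2 * π),
        Circle.exp x = q := by
      intro x hx
      have hx' : Circle.exp x ∈ univ \ Circle.exp '' Ioo (θ + ((k : ℝ) + 1) * c)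
          (θ + ((k : ℝ) + 1) * (c + ℓ)) := by
        rw [hdiff]; exact ⟨x, hx, rfl⟩
      by_contra hne
      exact hx'.2 (h hne)
    have h1 := hout (θ + ((k : ℝ) + 1) * (c + ℓ)) ⟨le_rfl, by nlinarith⟩
    have h2 := hout (θ + ((k : ℝ) + 1) * c + 2 * π) ⟨by nlinarith, le_rfl⟩
    obtain ⟨m, hm⟩ := Circle.exp_eq_exp.mp (h1.trans h2.symm)
    have hm' : ((k : ℝ) + 1) * ℓ = ((m : ℝ) + 1) * (2 * π) := by linarith
    have hm0 : (0 : ℝ) < (m : ℝ) + 1 := by nlinarith [two_pi_pos]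
    have hm1 : (m : ℝ) + 1 < 1 := by nlinarith [two_pi_pos]
    have hmz : 0 < m + 1 := by exact_mod_cast hm0
    have hmz' : m + 1 < 1 := by exact_mod_cast hm1
    omega
  -- hence `φ_{2(k+1)}` wraps the arc `A` of length `ℓ` around all of `S¹`
  apply phi_image_exp_image_Ioo_eq_univ
  rw [show ((2 * ((k + 1 : ℕ) : ℤ) : ℤ) : ℝ) = 2 * ((k : ℝ) + 1) by push_cast; ring,
    abs_of_pos (by positivity)]
  nlinarith [two_pi_pos]

end CircleOpens

namespace ArchFrd

/-! ### Transport to `O_ℂ^× = normOneSubgroup ℂ` -/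

/-- The circle-geometry step on `O_ℂ^×`: if a translate of the `d`-fold product of a connected open
`B ⊆ O_ℂ^×` (`d ≥ 1`) misses at most one point, then every point of `O_ℂ^×` is a `2d`-th power of a
point of `B`. [cite: MochizukiFrdII2008, Prop 3.4 (ii) p.30] -/
theorem exists_mem_pow_eq_of_compl_subset {B : Set ↥(normOneSubgroup ℂ)} (hBc : IsConnected B)
    (hBo : IsOpen B) {d : ℕ} (hd : 0 < d) {e q : ↥(normOneSubgroup ℂ)}
    (h : ({q}ᶜ : Set ↥(normOneSubgroup ℂ)) ⊆ e • B ^ d) (t : ↥(normOneSubgroup ℂ)) :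
    ∃ p ∈ B, p ^ (2 * d) = t := by
  obtain ⟨E, H, hEH, -⟩ := exists_unitCircleEquiv
  have hcont : Continuous E := H.continuous.congr hEH
  have hpre : (E : Circle → ↥(normOneSubgroup ℂ)) ⁻¹' B = H.symm '' B := by
    rw [congrFun H.image_symm B]
    ext z
    show E z ∈ B ↔ H z ∈ B
    rw [hEH]
  have hAc : IsConnected ((E : Circle → ↥(normOneSubgroup ℂ)) ⁻¹' B) := by
    rw [hpre]
    exact hBc.image _ H.symm.continuous.continuousOn
  have hAo : IsOpen ((E : Circle → ↥(normOneSubgroup ℂ)) ⁻¹' B) := by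
    rw [hpre]
    exact H.symm.isOpen_image.mpr hBo
  -- the hypothesis, pulled back along `E`
  have h' : ({E.symm q}ᶜ : Set Circle) ⊆
      E.symm e • ((E : Circle → ↥(normOneSubgroup ℂ)) ⁻¹' B) ^ d := by
    intro z hz
    have hz' : E z ∈ ({q}ᶜ : Set ↥(normOneSubgroup ℂ)) := by
      intro hzq
      apply hz
      show z = E.symm q
      rw [← hzq, E.symm_apply_apply]
    obtain ⟨y, hy, hEz⟩ := h hz'
    have hpre' : (E : Circle → ↥(normOneSubgroup ℂ)) ⁻¹' B = E.symm '' B := by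
      ext w
      constructor
      · intro hw
        exact ⟨E w, hw, E.symm_apply_apply w⟩
      · rintro ⟨u, hu, rfl⟩
        show E (E.symm u) ∈ B
        rw [E.apply_symm_apply]
        exact hu
    refine ⟨E.symm y, ?_, ?_⟩
    · rw [hpre', ← Set.image_pow]
      exact ⟨y, hy, rfl⟩
    · show E.symm e * E.symm y = z
      rw [← map_mul, show e * y = E z from hEz, E.symm_apply_apply]
  have huniv := CircleOpens.phi_image_eq_univ_of_compl_subset hAc hAo hd h'
  have ht : E.symm t ∈ CircleOpens.phi (2 * (d : ℤ)) '' ((E : Circle → ↥(normOneSubgroup ℂ)) ⁻¹' B) := by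
    rw [huniv]; exact mem_univ _
  obtain ⟨z, hz, hzt⟩ := ht
  refine ⟨E z, hz, ?_⟩
  have hzt' : z ^ (2 * d) = E.symm t := by
    rw [← hzt]
    show z ^ (2 * d) = z ^ (2 * (d : ℤ))
    rw [← zpow_natCast]
    push_cast
    rfl
  rw [← map_pow, hzt', E.apply_symm_apply]

/-! ### The conjugate pair of lifts from the geometric content of condition (b) -/

namespace C0

/-- **Prop. 3.4 (ii), condition (b), the lifting step** (p. 30 ll. 34–38): for `φ₀ : X → Y` in `C₀`
with `X` complex and `Y` real, if a translate of the `deg_Fr(φ₀)`-fold product of the angular part of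
`X` misses at most one point of `S¹`, then there are an object `Z` over `Spec ℂ` and linear isometries
`a₀ = (id, 1, 1)`, `b₀ = (conj, 1, w) : Z → X` with `φ₀ ∘ a₀ = φ₀ ∘ b₀`.
[cite: MochizukiFrdII2008, Prop 3.4 (ii) p.30] -/
theorem exists_conj_pair_of_compl_subset (RX : AngularRegion ℂ)
    (hRX : D0.complex = D0.real → RX.IsIsotropic) (RY : AngularRegion ℂ)
    (hRY : D0.real = D0.real → RY.IsIsotropic)
    (φ : C0.mk D0.complex RX hRX ⟶ C0.mk D0.real RY hRY)
    {e q : ↥(normOneSubgroup ℂ)}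
    (hbig : ({q}ᶜ : Set ↥(normOneSubgroup ℂ)) ⊆ e • RX.dir ^ (degFr φ : ℕ)) :
    ∃ (RZ : AngularRegion ℂ) (hRZ : D0.complex = D0.real → RZ.IsIsotropic)
      (a b : C0.mk D0.complex RZ hRZ ⟶ C0.mk D0.complex RX hRX),
      Base a = 𝟙 D0.complex ∧ Base b = D0.conj ∧ degFr a = 1 ∧ degFr b = 1 ∧
        PreFrobenioid.IsIsometry toElem a ∧ PreFrobenioid.IsIsometry toElem b ∧ a ≫ φ = b ≫ φ := by
  set v := unitPart ℂ (scalar φ) with hv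
  obtain ⟨p, hp, hpd⟩ := exists_mem_pow_eq_of_compl_subset RX.isConnected_dir RX.isOpen_dir
    (degFr φ).pos hbig (v ^ 2)⁻¹
  obtain ⟨A', hA'c, hA'o, hsub, w, hwd, hconj⟩ :=
    exists_inv_eq_smul_of_pow_eq RX.isConnected_dir RX.isOpen_dir (degFr φ).pos v hp hpd
  refine exists_conj_pair RX hRX RY hRY φ hA'o hA'c hsub w hconj ?_
  -- `conj(c) · w^d = conj(c) · (c/|c|)² = c`
  have hw : ((w : ℂˣ) : ℂ) ^ (degFr φ : ℕ) = ((v : ℂˣ) : ℂ) ^ 2 := by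
    rw [← Units.val_pow_eq_pow_val, ← Units.val_pow_eq_pow_val, ← Subgroup.coe_pow,
      ← Subgroup.coe_pow, hwd]
  apply Units.ext
  rw [Units.val_mul, D0.galAct_true, Units.coe_star, Units.val_pow_eq_pow_val, hw]
  have hvc : ((v : ℂˣ) : ℂ) = (scalar φ : ℂ) * ((‖(scalar φ : ℂ)‖ : ℝ) : ℂ)⁻¹ := by
    rw [hv]
    show (((scalar φ) * (ofPosReal ℂ (absHom ℂ (scalar φ)))⁻¹ : ℂˣ) : ℂ) = _
    rw [Units.val_mul, Units.val_inv_eq_inv_val, coe_ofPosReal, coe_absHom]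
    rfl
  have hn : ((‖(scalar φ : ℂ)‖ : ℝ) : ℂ) ≠ 0 := by
    exact_mod_cast (norm_pos_iff.mpr (scalar φ).ne_zero).ne'
  rw [hvc, ← starRingEnd_apply]
  have hcs : starRingEnd ℂ (scalar φ : ℂ) * (scalar φ : ℂ) = ((‖(scalar φ : ℂ)‖ : ℝ) : ℂ) ^ 2 := by
    rw [mul_comm, Complex.mul_conj, Complex.normSq_eq_norm_sq]
    push_cast
    ring
  have key : starRingEnd ℂ (scalar φ : ℂ) * ((scalar φ : ℂ) * (((‖(scalar φ : ℂ)‖ : ℝ) : ℂ))⁻¹) ^ 2 =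
      (starRingEnd ℂ (scalar φ : ℂ) * (scalar φ : ℂ)) * (scalar φ : ℂ) *
        ((((‖(scalar φ : ℂ)‖ : ℝ) : ℂ))⁻¹) ^ 2 := by
    ring
  rw [key, hcs]
  field_simp

end C0

end ArchFrd

end

end Literature.AlgebraicGeometry.Frobenioids
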